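import Literature.NumberTheory.Sieve.HeathBrownCubicTypeIILSBridge
import Literature.NumberTheory.Sieve.HeathBrownCubicTypeIISmallQ
import HarnessLib

/-!
# Heath-Brown's Lemma 3.10, §13 pp. 81–83: `∑_{q ≤ d₀} w(q) ∑*_{b} |S(b/q; C)|²` for one good cube

Support for the proof of **Lemma 3.10** of D. R. Heath-Brown, *Primes represented by `x³ + 2y³`*,
Acta Math. 186 (2001), §13 pp. 81–83:

> "We shall now use Lemma 13.1 to handle the contribution to (13.2) arising from terms with `q > Q₀`,
> say. We cover the range `Q₀ < q ≤ d₀` with intervals `Q < q ≤ 2Q`, where `Q` runs over powers of `2`. …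
> we conclude that the range `Q < q ≤ 2Q` contributes `≪ XYV⁻¹Q⁻¹ … (V + Q²V^{2/3} + Q⁴) V(log X)^c` to
> `S₈`. … There remains the range `q ≤ Q₀`, where we shall use the hypothesis (3.14). … The terms with
> `q ≤ Q₀` therefore contribute `≪ XYV⁻¹(Q₀⁴ … + Q₀ …)(log X)^c` to (13.2)."

For one lattice cube `C` of side `S₀` satisfying the conditions of (3.14) we PROVE the bound for
`∑_{q ≤ d₀} w(q) U*(C, q)` in closed form (`sum_wt_Ustar_le`): the range `q ≤ Q₀` by `norm_Sfrac_Fprim_le`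
(`HeathBrownCubicTypeIISmallQ`, with `G = Q₁/Q₀`), the range `q > Q₀` by dyadic blocks
`(Q₀2^j, Q₀2^{j+1}]`, the weight bound `w(q) ≤ 4(1 + log q)/(qΔ₀)` (`wt_le`) and Lemma 13.1
(`sum_Ustar_dyadic_le`), with the geometric sums `∑ 2^{−j} ≤ 2`, `∑ 2^j Q₀ ≤ 2d₀`, `∑ 8^j Q₀³ ≤ (8/7)d₀³`.

## References

* D. R. Heath-Brown, *Primes represented by `x³ + 2y³`*, Acta Math. 186 (2001), §13 pp. 81–83.
  [cite: HeathBrownActa2001, §13 pp. 81–83]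

## Mathlib / tree search

Tree: `HeathBrownCubicTypeIILSBridge` (`sum_Ustar_dyadic_le`), `HeathBrownCubicTypeIISmallQ`
(`norm_Sfrac_Fprim_le`), `HeathBrownCubicTypeIIWeights` (`wt`, `wt_le`, `Ustar`, `primRes`),
`HeathBrownCubicTypeIICharSum` (`card_resVecs`).
-/

noncomputable section

open Finset NumberField

namespace Literature.NumberTheory.Sieve.CubicSieve

open LFunctions.CubeRootTwoField CubicPrimes LargeSieve

/-! ### `U*(q) ≤ q³ B²` -/

open scoped Classical in
/-- `#primRes q ≤ q³`. [folklore] -/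
theorem card_primRes_le (q : ℕ) : #(primRes q) ≤ q ^ 3 := by
  classical
  rw [primRes, ← card_resVecs q]; exact card_filter_le _ _

/-- `U*(q) ≤ q³ B²` when `|S(b/q)| ≤ B` for all `b`. [folklore] -/
theorem Ustar_le_of_bound (w : ℤ × ℤ × ℤ → ℝ) (C : Finset (ℤ × ℤ × ℤ)) (q : ℕ) {B : ℝ} (hB : 0 ≤ B)
    (h : ∀ b, ‖Sfrac w C q b‖ ≤ B) : Ustar w C q ≤ (q : ℝ) ^ 3 * B ^ 2 := by
  classical
  calc Ustar w C q ≤ ∑ _b ∈ primRes q, B ^ 2 := sum_le_sum fun b _ => by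
        have := h b; have h0 := norm_nonneg (Sfrac w C q b); nlinarith
    _ = #(primRes q) * B ^ 2 := by rw [sum_const, nsmul_eq_mul]
    _ ≤ (q : ℝ) ^ 3 * B ^ 2 := by gcongr; exact_mod_cast card_primRes_le q

/-! ### The dyadic block index -/

/-- The block index `j(q) = log₂((q − 1)/Q₀)` of `q > Q₀`: `Q₀2^j < q ≤ Q₀2^{j+1}`. [cite: HeathBrownActa2001, §13 p. 81] -/
def blockIdx (Q₀ q : ℕ) : ℕ := Nat.log 2 ((q - 1) / Q₀)

/-- For `Q₀ ≥ 1` and `q > Q₀`: `Q₀ 2^{j(q)} < q ≤ Q₀ 2^{j(q)+1}`. [folklore] -/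
theorem mem_block_of_gt {Q₀ q : ℕ} (hQ₀ : 1 ≤ Q₀) (hq : Q₀ < q) :
    q ∈ Ioc (Q₀ * 2 ^ blockIdx Q₀ q) (Q₀ * 2 ^ (blockIdx Q₀ q + 1)) := by
  set mq := (q - 1) / Q₀ with hmq
  have hm1 : 1 ≤ mq := by
    rw [hmq]; exact (Nat.le_div_iff_mul_le (by omega)).mpr (by omega)
  have hlo : 2 ^ blockIdx Q₀ q ≤ mq := Nat.pow_log_le_self 2 (by omega)
  have hhi : mq < 2 ^ (blockIdx Q₀ q + 1) := Nat.lt_pow_succ_log_self (by norm_num) mq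
  rw [mem_Ioc]
  constructor
  · -- `Q₀ 2^j ≤ Q₀ mq ≤ q - 1 < q`
    have h1 : Q₀ * mq ≤ q - 1 := by rw [hmq, mul_comm]; exact Nat.div_mul_le_self (q - 1) Q₀
    calc Q₀ * 2 ^ blockIdx Q₀ q ≤ Q₀ * mq := Nat.mul_le_mul_left _ hlo
      _ ≤ q - 1 := h1
      _ < q := by omega
  · -- `mq < 2^{j+1}` gives `q - 1 < Q₀ 2^{j+1}`
    have h1 : q - 1 < 2 ^ (blockIdx Q₀ q + 1) * Q₀ := (Nat.div_lt_iff_lt_mul (by omega)).mp hhi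
    rw [mul_comm] at h1; omega

/-- For `q ≤ d₀`: `j(q) < log₂⌊d₀/Q₀⌋₊ + 1` and `Q₀ 2^{j(q)} ≤ d₀`. [folklore] -/
theorem blockIdx_lt {Q₀ q : ℕ} (hQ₀ : 1 ≤ Q₀) {d₀ : ℝ} (hqd : (q : ℝ) ≤ d₀) :
    blockIdx Q₀ q < Nat.log 2 ⌊d₀ / Q₀⌋₊ + 1 := by
  have hQR : (0 : ℝ) < Q₀ := by exact_mod_cast hQ₀
  have hm : (q - 1) / Q₀ ≤ ⌊d₀ / Q₀⌋₊ := by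
    apply Nat.le_floor
    rw [le_div_iff₀ hQR]
    have h1 : (((q - 1) / Q₀ : ℕ) : ℝ) * Q₀ ≤ ((q - 1 : ℕ) : ℝ) := by
      exact_mod_cast Nat.div_mul_le_self (q - 1) Q₀
    have h2 : ((q - 1 : ℕ) : ℝ) ≤ q := by exact_mod_cast Nat.sub_le q 1
    linarith
  rw [blockIdx, Nat.lt_succ_iff]
  exact Nat.log_mono_right hm

/-- `Q₀ 2^j ≤ d₀` for `j < log₂⌊d₀/Q₀⌋₊ + 1` (`Q₀ ≥ 1`, `⌊d₀/Q₀⌋₊ ≥ 1`). [folklore] -/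
theorem block_le {Q₀ : ℕ} (hQ₀ : 1 ≤ Q₀) {d₀ : ℝ} (hd : 1 ≤ ⌊d₀ / Q₀⌋₊) {j : ℕ} (hj : j < Nat.log 2 ⌊d₀ / Q₀⌋₊ + 1) :
    ((Q₀ * 2 ^ j : ℕ) : ℝ) ≤ d₀ := by
  have hQR : (0 : ℝ) < Q₀ := by exact_mod_cast hQ₀
  have h1 : 2 ^ j ≤ ⌊d₀ / Q₀⌋₊ := by
    calc 2 ^ j ≤ 2 ^ Nat.log 2 ⌊d₀ / Q₀⌋₊ := Nat.pow_le_pow_right (by norm_num) (by omega)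
      _ ≤ ⌊d₀ / Q₀⌋₊ := Nat.pow_log_le_self 2 (by omega)
  have hpos : 0 ≤ d₀ / Q₀ := by
    by_contra hneg; push Not at hneg
    have : ⌊d₀ / Q₀⌋₊ = 0 := Nat.floor_eq_zero.mpr (by linarith)
    omega
  have h2 : ((2 ^ j : ℕ) : ℝ) ≤ d₀ / Q₀ := le_trans (by exact_mod_cast h1) (Nat.floor_le hpos)
  rw [le_div_iff₀ hQR] at h2
  push_cast at h2 ⊢
  linarith

/-- Geometric sums: `∑_{j<K} 2^{-j} ≤ 2`, `∑_{j<K} 2^j < 2^K`, `∑_{j<K} 8^j < 8^K / 7 · 8/8`… in the forms used. [folklore] -/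
theorem geom_sums (K : ℕ) :
    ∑ j ∈ range K, ((2 : ℝ) ^ j)⁻¹ ≤ 2 ∧ ∑ j ∈ range K, (2 : ℝ) ^ j ≤ 2 ^ K ∧ ∑ j ∈ range K, (8 : ℝ) ^ j ≤ 8 ^ K / 7 := by
  refine ⟨?_, ?_, ?_⟩
  · have := geom_sum_Ico_le_of_lt_one (x := (1 / 2 : ℝ)) (m := 0) (n := K) (by norm_num) (by norm_num)
    rw [← range_eq_Ico] at this
    calc ∑ j ∈ range K, ((2 : ℝ) ^ j)⁻¹ = ∑ j ∈ range K, (1 / 2 : ℝ) ^ j := by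
          refine sum_congr rfl fun j _ => ?_; rw [one_div, inv_pow]
      _ ≤ (1 / 2 : ℝ) ^ 0 / (1 - 1 / 2) := this
      _ = 2 := by norm_num
  · have := geom_sum_eq (x := (2 : ℝ)) (by norm_num) K
    rw [this]; norm_num
  · have := geom_sum_eq (x := (8 : ℝ)) (by norm_num) K
    rw [this]
    have : (0 : ℝ) < 8 ^ K := by positivity
    rw [div_le_div_iff₀ (by norm_num) (by norm_num)]
    nlinarith

/-! ### The bound for one cube -/

set_option maxHeartbeats 1000000 in
open scoped Classical in
/-- **`∑_{q ≤ d₀} w(q) U*(C, q)` for a cube `C` satisfying the conditions of (3.14)** (`Q₀ ≥ 1`, `Q₀ ≤ Q₁`,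
`d₀ ≥ 1`, `Δ₀ > 0`): the range `q ≤ Q₀` by (3.14) and Hölder, the range `q > Q₀` by the dyadic large sieve.
[cite: HeathBrownActa2001, §13 pp. 81–83] -/
theorem sum_wt_Ustar_le {X τ : ℝ} (hX : 1 < X) (hτ : 0 < τ) (hτ1 : τ ≤ 1) {nn : ℕ} {m : Fin (nn + 1) → ℕ}
    (hm : CoreAdmissible τ m) {Q₁ C₁ c₁ c₃ c₄ : ℝ} (hHyp : Hyp314 X τ m Q₁ C₁ c₁ c₃ c₄) {V : ℝ} (hV : 0 < V)
    {a : ℝ × ℝ × ℝ} {S₀ : ℝ} (hS : 0 ≤ S₀) (hsL : hbL X τ ^ 2 ≤ S₀) (hcube : CubeCond c₃ c₄ V a S₀)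
    (hC0 : ∀ v ∈ latticeCube a S₀, v ≠ 0) {M : ℕ} (hM : ∀ v ∈ latticeCube a S₀, hcf3 v ≤ M)
    {Q₀ : ℕ} (hQ₀ : 1 ≤ Q₀) (hQ₀₁ : (Q₀ : ℝ) ≤ Q₁) {Δ₀ : ℝ} (hΔ : 0 < Δ₀) {d₀ : ℝ} (hd₀ : 1 ≤ d₀) (Dmax : ℕ) :
    ∑ q ∈ Icc 1 ⌊d₀⌋₊, wt Δ₀ Dmax d₀ q * Ustar (Fprim X τ m) (latticeCube a S₀) q ≤
      4 * (1 + Real.log Q₀) / Δ₀ * (Q₀ : ℝ) ^ 3 *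
          (2 * ((Q₀ : ℝ) ^ 4 * Q₁ ^ 2 * (C₁ * V * Real.exp (-(c₁ * Real.sqrt (Real.log (hbL X τ))))) ^ 2 +
            162 * ((∑ v ∈ latticeCube a S₀, (idealDivisorCount (Ideal.span {coordElt v}) : ℝ) ^ 3) ^ (1 / 3 : ℝ)) ^ 2 *
              (∑ g ∈ Ioc ⌊Q₁ / Q₀⌋₊ M, (S₀ / g + 1) ^ 2) ^ 2)) +
        414720 * (1 + Real.log (2 * d₀)) / Δ₀ *
          ((((⌊S₀⌋₊ + 1 : ℕ) : ℝ)) ^ 3 / Q₀ + d₀ * (((⌊S₀⌋₊ + 1 : ℕ) : ℝ)) ^ 2 + d₀ ^ 3) *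
          ∑ v ∈ latticeCube a S₀, Fprim X τ m v ^ 2 := by
  classical
  set C := latticeCube a S₀ with hC
  set F := Fprim X τ m with hF
  set H : ℝ := C₁ * V * Real.exp (-(c₁ * Real.sqrt (Real.log (hbL X τ)))) with hH
  set S3r : ℝ := (∑ v ∈ C, (idealDivisorCount (Ideal.span {coordElt v}) : ℝ) ^ 3) ^ (1 / 3 : ℝ) with hS3r
  set G : ℝ := Q₁ / Q₀ with hG
  set R : ℝ := ∑ g ∈ Ioc ⌊G⌋₊ M, (S₀ / g + 1) ^ 2 with hR
  set N' : ℕ := ⌊S₀⌋₊ + 1 with hN'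
  set F2 : ℝ := ∑ v ∈ C, F v ^ 2 with hF2
  have hQR : (0 : ℝ) < Q₀ := by exact_mod_cast hQ₀
  have hQR1 : (1 : ℝ) ≤ Q₀ := by exact_mod_cast hQ₀
  have hG1 : 1 ≤ G := by rw [hG, le_div_iff₀ hQR]; linarith
  have hQG : (Q₀ : ℝ) * G = Q₁ := by rw [hG]; field_simp
  have hS3r0 : 0 ≤ S3r := Real.rpow_nonneg (sum_nonneg fun v _ => by positivity) _
  have hR0 : 0 ≤ R := sum_nonneg fun g _ => by positivity
  have hF20 : 0 ≤ F2 := sum_nonneg fun v _ => by positivity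
  clear_value F2
  have hH0 : 0 ≤ H := by
    have h1 : (1 : ℝ) ≤ Q₁ := hQR1.trans hQ₀₁
    have := hHyp 1 le_rfl (by simpa using h1) 0 V a S₀ hV hsL hcube
    exact (abs_nonneg _).trans this
  have hlogQ : 0 ≤ Real.log Q₀ := Real.log_nonneg hQR1
  have hlogd : 0 ≤ Real.log (2 * d₀) := Real.log_nonneg (by linarith)
  have hwt : ∀ q : ℕ, 1 ≤ q → wt Δ₀ Dmax d₀ q ≤ 4 * (1 + Real.log q) / (q * Δ₀) := fun q hq => wt_le hΔ Dmax d₀ hq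
  -- split at `Q₀`
  rw [← sum_filter_add_sum_filter_not (Icc 1 ⌊d₀⌋₊) (fun q => q ≤ Q₀)]
  refine add_le_add ?_ ?_
  · ---- small `q`
    set B : ℝ := (Q₀ : ℝ) ^ 3 * G * H + 9 * S3r * R with hB
    have hB0 : 0 ≤ B := by positivity
    have hterm : ∀ q ∈ (Icc 1 ⌊d₀⌋₊).filter (fun q => q ≤ Q₀),
        wt Δ₀ Dmax d₀ q * Ustar F C q ≤ 4 * (1 + Real.log Q₀) / Δ₀ * (Q₀ : ℝ) ^ 2 * B ^ 2 := by
      intro q hq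
      rw [mem_filter, mem_Icc] at hq
      obtain ⟨⟨hq1, -⟩, hqQ⟩ := hq
      have hqR : (1 : ℝ) ≤ q := by exact_mod_cast hq1
      have hqQR : (q : ℝ) ≤ Q₀ := by exact_mod_cast hqQ
      have hqG : (q : ℝ) * G ≤ Q₁ := by rw [← hQG]; exact mul_le_mul_of_nonneg_right hqQR (by linarith)
      -- `|S(b/q)| ≤ B`
      have hSb : ∀ b, ‖Sfrac F C q b‖ ≤ B := by
        intro b
        have h := norm_Sfrac_Fprim_le hX hτ hτ1 hm hHyp hV hS hsL hcube hC0 hM hq1 hG1 hqG b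
        rw [← hC, ← hH, ← hS3r, ← hR] at h
        refine h.trans ?_
        rw [hB]
        have : (q : ℝ) ^ 3 * G * H ≤ (Q₀ : ℝ) ^ 3 * G * H := by gcongr
        linarith
      have hU := Ustar_le_of_bound F C q hB0 hSb
      have hw := hwt q hq1
      have hlogq : Real.log q ≤ Real.log Q₀ := Real.log_le_log (by linarith) hqQR
      have hlogq0 : 0 ≤ Real.log q := Real.log_nonneg hqR
      calc wt Δ₀ Dmax d₀ q * Ustar F C q ≤ (4 * (1 + Real.log q) / (q * Δ₀)) * ((q : ℝ) ^ 3 * B ^ 2) :=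
            mul_le_mul hw hU (Ustar_nonneg _ _ _) (by positivity)
        _ = 4 * (1 + Real.log q) / Δ₀ * (q : ℝ) ^ 2 * B ^ 2 := by field_simp
        _ ≤ 4 * (1 + Real.log Q₀) / Δ₀ * (Q₀ : ℝ) ^ 2 * B ^ 2 := by gcongr
    calc ∑ q ∈ (Icc 1 ⌊d₀⌋₊).filter (fun q => q ≤ Q₀), wt Δ₀ Dmax d₀ q * Ustar F C q
        ≤ ∑ _q ∈ (Icc 1 ⌊d₀⌋₊).filter (fun q => q ≤ Q₀), 4 * (1 + Real.log Q₀) / Δ₀ * (Q₀ : ℝ) ^ 2 * B ^ 2 :=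
          sum_le_sum hterm
      _ = #((Icc 1 ⌊d₀⌋₊).filter (fun q => q ≤ Q₀)) * (4 * (1 + Real.log Q₀) / Δ₀ * (Q₀ : ℝ) ^ 2 * B ^ 2) := by
          rw [sum_const, nsmul_eq_mul]
      _ ≤ Q₀ * (4 * (1 + Real.log Q₀) / Δ₀ * (Q₀ : ℝ) ^ 2 * B ^ 2) := by
          gcongr
          have : (Icc 1 ⌊d₀⌋₊).filter (fun q => q ≤ Q₀) ⊆ Icc 1 Q₀ := by
            intro q hq; rw [mem_filter, mem_Icc] at hq; rw [mem_Icc]; exact ⟨hq.1.1, hq.2⟩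
          exact_mod_cast (card_le_card this).trans (by simp)
      _ = 4 * (1 + Real.log Q₀) / Δ₀ * (Q₀ : ℝ) ^ 3 * B ^ 2 := by ring
      _ ≤ 4 * (1 + Real.log Q₀) / Δ₀ * (Q₀ : ℝ) ^ 3 *
            (2 * ((Q₀ : ℝ) ^ 4 * Q₁ ^ 2 * H ^ 2 + 162 * S3r ^ 2 * R ^ 2)) := by
          gcongr
          rw [hB]
          have e1 : (Q₀ : ℝ) ^ 3 * G = (Q₀ : ℝ) ^ 2 * Q₁ := by
            rw [← hQG]; ring
          rw [e1]
          nlinarith [sq_nonneg ((Q₀ : ℝ) ^ 2 * Q₁ * H - 9 * S3r * R)]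
      _ = _ := by ring
  · ---- large `q`: dyadic blocks
    set Sq := (Icc 1 ⌊d₀⌋₊).filter (fun q => ¬q ≤ Q₀) with hSq
    by_cases hempty : Sq = ∅
    · rw [hempty, sum_empty]
      have : 0 ≤ ((N' : ℝ)) ^ 3 / Q₀ + d₀ * (N' : ℝ) ^ 2 + d₀ ^ 3 := by positivity
      positivity
    -- `⌊d₀/Q₀⌋₊ ≥ 1`
    have hu : 1 ≤ ⌊d₀ / Q₀⌋₊ := by
      obtain ⟨q, hq⟩ := nonempty_iff_ne_empty.mpr hempty
      rw [hSq, mem_filter, mem_Icc] at hq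
      obtain ⟨⟨-, hqd⟩, hqQ⟩ := hq
      apply Nat.le_floor
      rw [Nat.cast_one, le_div_iff₀ hQR, one_mul]
      have h1 : (Q₀ : ℝ) < q := by exact_mod_cast (not_le.mp hqQ)
      have h2 : (q : ℝ) ≤ ⌊d₀⌋₊ := by exact_mod_cast hqd
      have h3 : (⌊d₀⌋₊ : ℝ) ≤ d₀ := Nat.floor_le (by linarith)
      linarith
    set K : ℕ := Nat.log 2 ⌊d₀ / Q₀⌋₊ + 1 with hK
    -- fibre over the block index
    have hmaps : ∀ q ∈ Sq, blockIdx Q₀ q ∈ range K := by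
      intro q hq
      rw [hSq, mem_filter, mem_Icc] at hq
      obtain ⟨⟨-, hqd⟩, -⟩ := hq
      rw [mem_range, hK]
      refine blockIdx_lt hQ₀ (le_trans (by exact_mod_cast hqd) (Nat.floor_le (by linarith)))
    rw [← sum_fiberwise_of_maps_to hmaps]
    -- each block
    have hblock : ∀ j ∈ range K,
        ∑ q ∈ Sq.filter (fun q => blockIdx Q₀ q = j), wt Δ₀ Dmax d₀ q * Ustar F C q ≤
          4 * (1 + Real.log (2 * d₀)) / Δ₀ * 51840 *
            ((N' : ℝ) ^ 3 * ((Q₀ : ℝ) * 2 ^ j)⁻¹ + ((Q₀ : ℝ) * 2 ^ j) * (N' : ℝ) ^ 2 + ((Q₀ : ℝ) * 2 ^ j) ^ 3) * F2 := by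
      intro j hj
      rw [mem_range] at hj
      set Qj : ℕ := Q₀ * 2 ^ j with hQj
      have hQj0 : (0 : ℝ) < Qj := by rw [hQj]; positivity
      have hQjR : (Qj : ℝ) = (Q₀ : ℝ) * 2 ^ j := by rw [hQj]; push_cast; ring
      have hQjd : (Qj : ℝ) ≤ d₀ := by rw [hQj]; exact block_le hQ₀ hu hj
      -- fibre ⊆ block
      have hsub : Sq.filter (fun q => blockIdx Q₀ q = j) ⊆ Ioc Qj (2 * Qj) := by
        intro q hq
        rw [mem_filter, hSq, mem_filter] at hq
        obtain ⟨⟨-, hqQ⟩, hjq⟩ := hq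
        have hb := mem_block_of_gt hQ₀ (not_le.mp hqQ)
        rw [hjq, mem_Ioc] at hb
        rw [mem_Ioc, hQj]
        refine ⟨hb.1, hb.2.trans (le_of_eq ?_)⟩
        ring
      -- weight on the block
      have hwq : ∀ q ∈ Ioc Qj (2 * Qj), wt Δ₀ Dmax d₀ q ≤ 4 * (1 + Real.log (2 * d₀)) / Δ₀ * ((Qj : ℝ))⁻¹ := by
        intro q hq
        rw [mem_Ioc] at hq
        have hq1 : 1 ≤ q := by
          have : 1 ≤ Qj := by
            rw [hQj]; exact le_trans (by norm_num) (Nat.mul_le_mul hQ₀ Nat.one_le_two_pow)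
          omega
        have hqR : (Qj : ℝ) < q := by exact_mod_cast hq.1
        have hq2 : (q : ℝ) ≤ 2 * d₀ := by
          have : (q : ℝ) ≤ 2 * Qj := by exact_mod_cast hq.2
          linarith
        have hq0 : (0 : ℝ) < q := by linarith
        have hlog : Real.log q ≤ Real.log (2 * d₀) := Real.log_le_log hq0 hq2
        have hlog0 : 0 ≤ Real.log q := Real.log_nonneg (by exact_mod_cast hq1)
        calc wt Δ₀ Dmax d₀ q ≤ 4 * (1 + Real.log q) / (q * Δ₀) := hwt q hq1
          _ = 4 * (1 + Real.log q) / Δ₀ * ((q : ℝ))⁻¹ := by field_simp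
          _ ≤ 4 * (1 + Real.log (2 * d₀)) / Δ₀ * ((Qj : ℝ))⁻¹ := by
              gcongr
      have hLS := sum_Ustar_dyadic_le (a := a) (S₀ := S₀) (C := C) (subset_refl _) F Qj
      rw [← hN', ← hF2] at hLS
      calc ∑ q ∈ Sq.filter (fun q => blockIdx Q₀ q = j), wt Δ₀ Dmax d₀ q * Ustar F C q
          ≤ ∑ q ∈ Ioc Qj (2 * Qj), wt Δ₀ Dmax d₀ q * Ustar F C q :=
            sum_le_sum_of_subset_of_nonneg hsub fun q _ _ => mul_nonneg (wt_nonneg' q) (Ustar_nonneg _ _ _)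
        _ ≤ ∑ q ∈ Ioc Qj (2 * Qj), (4 * (1 + Real.log (2 * d₀)) / Δ₀ * ((Qj : ℝ))⁻¹) * Ustar F C q :=
            sum_le_sum fun q hq => mul_le_mul_of_nonneg_right (hwq q hq) (Ustar_nonneg _ _ _)
        _ = (4 * (1 + Real.log (2 * d₀)) / Δ₀ * ((Qj : ℝ))⁻¹) * ∑ q ∈ Ioc Qj (2 * Qj), Ustar F C q := by
            rw [mul_sum]
        _ ≤ (4 * (1 + Real.log (2 * d₀)) / Δ₀ * ((Qj : ℝ))⁻¹) *
              (51840 * ((N' : ℝ) ^ 3 + (Qj : ℝ) ^ 2 * (N' : ℝ) ^ 2 + (Qj : ℝ) ^ 4) * F2) :=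
            mul_le_mul_of_nonneg_left hLS (by positivity)
        _ = 4 * (1 + Real.log (2 * d₀)) / Δ₀ * 51840 *
              ((N' : ℝ) ^ 3 * ((Qj : ℝ))⁻¹ + (Qj : ℝ) * (N' : ℝ) ^ 2 + (Qj : ℝ) ^ 3) * F2 := by
            field_simp
        _ = _ := by rw [hQjR]
    refine (sum_le_sum hblock).trans ?_
    -- geometric sums
    obtain ⟨g1, g2, g3⟩ := geom_sums K
    have hK2 : (2 : ℝ) ^ K ≤ 2 * (d₀ / Q₀) := by
      rw [hK, pow_succ]
      have h1 : ((2 ^ Nat.log 2 ⌊d₀ / Q₀⌋₊ : ℕ) : ℝ) ≤ ⌊d₀ / Q₀⌋₊ := by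
        exact_mod_cast Nat.pow_log_le_self 2 (by omega)
      have h2 : (⌊d₀ / Q₀⌋₊ : ℝ) ≤ d₀ / Q₀ := Nat.floor_le (by positivity)
      push_cast at h1
      nlinarith
    have hK8 : (8 : ℝ) ^ K ≤ 8 * (d₀ / Q₀) ^ 3 := by
      have : (8 : ℝ) ^ K = ((2 : ℝ) ^ K) ^ 3 := by rw [← pow_mul, mul_comm, pow_mul]; norm_num
      rw [this]
      have h0 : (0 : ℝ) ≤ 2 ^ K := by positivity
      calc ((2 : ℝ) ^ K) ^ 3 ≤ (2 * (d₀ / Q₀)) ^ 3 := pow_le_pow_left₀ h0 hK2 3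
        _ = 8 * (d₀ / Q₀) ^ 3 := by ring
    have hsum1 : ∑ j ∈ range K, (N' : ℝ) ^ 3 * ((Q₀ : ℝ) * 2 ^ j)⁻¹ ≤ 2 * ((N' : ℝ) ^ 3 / Q₀) := by
      have e : ∀ j : ℕ, (N' : ℝ) ^ 3 * ((Q₀ : ℝ) * 2 ^ j)⁻¹ = ((N' : ℝ) ^ 3 / Q₀) * ((2 : ℝ) ^ j)⁻¹ := by
        intro j; field_simp
      simp_rw [e]
      rw [← mul_sum]
      calc (N' : ℝ) ^ 3 / Q₀ * ∑ j ∈ range K, ((2 : ℝ) ^ j)⁻¹ ≤ (N' : ℝ) ^ 3 / Q₀ * 2 := by gcongr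
        _ = 2 * ((N' : ℝ) ^ 3 / Q₀) := by ring
    have hsum2 : ∑ j ∈ range K, ((Q₀ : ℝ) * 2 ^ j) * (N' : ℝ) ^ 2 ≤ 2 * d₀ * (N' : ℝ) ^ 2 := by
      have e : ∀ j : ℕ, ((Q₀ : ℝ) * 2 ^ j) * (N' : ℝ) ^ 2 = ((Q₀ : ℝ) * (N' : ℝ) ^ 2) * (2 : ℝ) ^ j := by intro j; ring
      simp_rw [e]
      rw [← mul_sum]
      calc (Q₀ : ℝ) * (N' : ℝ) ^ 2 * ∑ j ∈ range K, (2 : ℝ) ^ j ≤ (Q₀ : ℝ) * (N' : ℝ) ^ 2 * (2 * (d₀ / Q₀)) := by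
            gcongr; exact g2.trans hK2
        _ = 2 * d₀ * (N' : ℝ) ^ 2 := by field_simp
    have hsum3 : ∑ j ∈ range K, ((Q₀ : ℝ) * 2 ^ j) ^ 3 ≤ 8 / 7 * d₀ ^ 3 := by
      have e : ∀ j : ℕ, ((Q₀ : ℝ) * 2 ^ j) ^ 3 = (Q₀ : ℝ) ^ 3 * (8 : ℝ) ^ j := by
        intro j; rw [mul_pow, ← pow_mul, mul_comm j 3, pow_mul]; norm_num
      simp_rw [e]
      rw [← mul_sum]
      calc (Q₀ : ℝ) ^ 3 * ∑ j ∈ range K, (8 : ℝ) ^ j ≤ (Q₀ : ℝ) ^ 3 * (8 * (d₀ / Q₀) ^ 3 / 7) := by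
            gcongr; exact g3.trans (by rw [div_le_div_iff_of_pos_right (by norm_num)]; exact hK8)
        _ = 8 / 7 * d₀ ^ 3 := by field_simp
    have hcoef0 : 0 ≤ 4 * (1 + Real.log (2 * d₀)) / Δ₀ * 51840 := by positivity
    calc ∑ j ∈ range K, 4 * (1 + Real.log (2 * d₀)) / Δ₀ * 51840 *
          ((N' : ℝ) ^ 3 * ((Q₀ : ℝ) * 2 ^ j)⁻¹ + ((Q₀ : ℝ) * 2 ^ j) * (N' : ℝ) ^ 2 + ((Q₀ : ℝ) * 2 ^ j) ^ 3) * F2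
        = 4 * (1 + Real.log (2 * d₀)) / Δ₀ * 51840 *
          (∑ j ∈ range K, ((N' : ℝ) ^ 3 * ((Q₀ : ℝ) * 2 ^ j)⁻¹ + ((Q₀ : ℝ) * 2 ^ j) * (N' : ℝ) ^ 2 + ((Q₀ : ℝ) * 2 ^ j) ^ 3)) * F2 := by
          rw [mul_sum, sum_mul]
      _ ≤ 4 * (1 + Real.log (2 * d₀)) / Δ₀ * 51840 *
          (2 * ((N' : ℝ) ^ 3 / Q₀) + 2 * d₀ * (N' : ℝ) ^ 2 + 8 / 7 * d₀ ^ 3) * F2 := by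
          rw [sum_add_distrib, sum_add_distrib]
          gcongr
      _ ≤ 414720 * (1 + Real.log (2 * d₀)) / Δ₀ * ((N' : ℝ) ^ 3 / Q₀ + d₀ * (N' : ℝ) ^ 2 + d₀ ^ 3) * F2 := by
          have h1 : 0 ≤ (N' : ℝ) ^ 3 / Q₀ := by positivity
          have h2 : 0 ≤ d₀ * (N' : ℝ) ^ 2 := by positivity
          have h3 : 0 ≤ d₀ ^ 3 := by positivity
          have hL : 0 ≤ (1 + Real.log (2 * d₀)) / Δ₀ := by positivity
          have stuff : 207360 * (2 * ((N' : ℝ) ^ 3 / Q₀) + 2 * d₀ * (N' : ℝ) ^ 2 + 8 / 7 * d₀ ^ 3) ≤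
              414720 * ((N' : ℝ) ^ 3 / Q₀ + d₀ * (N' : ℝ) ^ 2 + d₀ ^ 3) := by linarith
          have : 4 * (1 + Real.log (2 * d₀)) / Δ₀ * 51840 * (2 * ((N' : ℝ) ^ 3 / Q₀) + 2 * d₀ * (N' : ℝ) ^ 2 + 8 / 7 * d₀ ^ 3) ≤
              414720 * (1 + Real.log (2 * d₀)) / Δ₀ * ((N' : ℝ) ^ 3 / Q₀ + d₀ * (N' : ℝ) ^ 2 + d₀ ^ 3) := by
            calc 4 * (1 + Real.log (2 * d₀)) / Δ₀ * 51840 * (2 * ((N' : ℝ) ^ 3 / Q₀) + 2 * d₀ * (N' : ℝ) ^ 2 + 8 / 7 * d₀ ^ 3)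
                = ((1 + Real.log (2 * d₀)) / Δ₀) * (207360 * (2 * ((N' : ℝ) ^ 3 / Q₀) + 2 * d₀ * (N' : ℝ) ^ 2 + 8 / 7 * d₀ ^ 3)) := by
                  ring
              _ ≤ ((1 + Real.log (2 * d₀)) / Δ₀) * (414720 * ((N' : ℝ) ^ 3 / Q₀ + d₀ * (N' : ℝ) ^ 2 + d₀ ^ 3)) :=
                  mul_le_mul_of_nonneg_left stuff hL
              _ = _ := by ring
          exact mul_le_mul_of_nonneg_right this hF20
  where
    wt_nonneg' (q : ℕ) : 0 ≤ wt Δ₀ Dmax d₀ q := sum_nonneg fun _ _ => sum_nonneg fun _ _ => by positivity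

end Literature.NumberTheory.Sieve.CubicSieve

end
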